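import Summits.QuantumFields.QCD.Theses.MultibosonBridge
import Literature.MathematicalPhysics.QuantumFieldTheory.Multiboson
import Literature.MathematicalPhysics.QuantumFieldTheory.QCDPhaseQuenched
import Literature.MathematicalPhysics.QuantumFieldTheory.LatticeGaugeProofs
import Literature.Barriers.QuantumFields.WilsonDeterminantSign

/-!
# Route `MultibosonBridge` (sub QCD) — support item `ReweightingIdentity` (stmt-QuantumFields-9601), PROVED

The exact multiboson reweighting bridge on every torus: for non-real root lists, every lattice-QCD torus
expectation `qcdTorusExpect β S m X = (∫ FI(X·e^{−ψ̄Dψ}))/(∫ FI(e^{−ψ̄Dψ}))` equals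
`E[FI(X·e^{−ψ̄Dψ})/W] / E[FI(e^{−ψ̄Dψ})/W]` with `E[g] := (∫ W·g)/(∫ W)`,
`W = ∏_f ∏_z |det(Γ₅D_W(m_f) − z)|⁻²`.  Proof: `W > 0` pointwise (`Γ₅D_W` Hermitian, `Im z ≠ 0`:
`det_sub_smul_one_ne_zero_of_isHermitian`), so `W·(g/W) = g` pointwise; and `∫ W > 0` — `W` is continuous
(`continuous_wilsonDirac`, `continuous_list_prod`) on the compact configuration space, hence integrable for the
Wilson probability measure — so the two normalisations `1/∫W` cancel.  A grounder candidate (g21-18,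
2026-08-15) exists on the item but is not readable from a prover jail; re-derived.

HONEST FRAMING: support bookkeeping; the route's cruxes and the summit conjunct `QCD` are untouched.
[cite: Luscher1994, §3 (3.7)–(3.9)]
-/

set_option autoImplicit false

namespace Summit.QuantumFields.QCD.Theorems.MultibosonBridge

open MeasureTheory
open Literature.MathematicalPhysics.QuantumFieldTheory
open Literature.MathematicalPhysics.QuantumLattice
open Literature.Probability.LatticeModels (TorusSite)

/-- The route's support item `ReweightingIdentity` (stmt-QuantumFields-9601) BY NAME.
[cite: Luscher1994, §3 (3.7)–(3.9)] -/
theorem reweightingIdentity_proof :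
    Summit.QuantumFields.QCD.Theses.MultibosonBridge.ReweightingIdentity := by
  intro Nf S _ β mq l X hz Dm W E
  -- every multiboson factor is invertible: `Γ₅ D_W` is Hermitian and `Im z ≠ 0`
  have hdet : ∀ (U : GaugeConfig 4 S (Matrix.specialUnitaryGroup (Fin 3) ℂ)) (f : Fin Nf) (z : ℂ),
      z ∈ l f → (spinorLift gammaFive * Dm S U (mq f) - z • (1 : Matrix _ _ ℂ)).det ≠ 0 := by
    intro U f z hzl
    have hH : (spinorLift gammaFive * Dm S U (mq f)).IsHermitian :=
      Literature.Barriers.QuantumFields.WilsonDeterminant.isHermitian_hermitianWilsonDirac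
        (fundamentalRep (Fin 3)) fundamentalRep_mem_unitaryGroup U (mq f) 1
    exact det_sub_smul_one_ne_zero_of_isHermitian hH (hz f z hzl)
  -- positivity and continuity of the weight
  have hWpos : ∀ U : GaugeConfig 4 S (Matrix.specialUnitaryGroup (Fin 3) ℂ), 0 < W S mq l U := by
    intro U
    refine inv_pos.2 (Finset.prod_pos fun f _ => List.prod_pos fun x hx => ?_)
    obtain ⟨z, hzl, rfl⟩ := List.mem_map.1 hx
    exact pow_pos (norm_pos_iff.2 (hdet U f z hzl)) 2
  have hWne : ∀ U : GaugeConfig 4 S (Matrix.specialUnitaryGroup (Fin 3) ℂ), (W S mq l U : ℂ) ≠ 0 :=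
    fun U => Complex.ofReal_ne_zero.2 (hWpos U).ne'
  have hWcont : Continuous fun U : GaugeConfig 4 S (Matrix.specialUnitaryGroup (Fin 3) ℂ) => W S mq l U := by
    have hD : ∀ μ : ℝ, Continuous fun U : GaugeConfig 4 S (Matrix.specialUnitaryGroup (Fin 3) ℂ) =>
        Dm S U μ := fun μ => continuous_wilsonDirac (fundamentalRep (Fin 3)) (continuous_fundamentalRep (Fin 3)) μ 1
    have hF : ∀ (f : Fin Nf) (z : ℂ), Continuous fun U : GaugeConfig 4 S (Matrix.specialUnitaryGroup (Fin 3) ℂ) =>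
        ‖(spinorLift gammaFive * Dm S U (mq f) - z • (1 : Matrix _ _ ℂ)).det‖ ^ 2 := fun f z =>
      (((continuous_const.mul (hD (mq f))).sub continuous_const).matrix_det.norm).pow 2
    have hP : Continuous fun U : GaugeConfig 4 S (Matrix.specialUnitaryGroup (Fin 3) ℂ) =>
        ∏ f, ((l f).map fun z => ‖(spinorLift gammaFive * Dm S U (mq f) - z • (1 : Matrix _ _ ℂ)).det‖ ^ 2).prod :=
      continuous_finsetProd _ fun f _ => continuous_list_prod (l f) fun z _ => hF f z
    refine hP.inv₀ fun U => ?_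
    have h := hWpos U
    simp only [W] at h
    exact (inv_pos.1 h).ne'
  -- the normalisation `∫ W` is positive
  haveI := isProbabilityMeasure_wilsonMeasure (d := 4) (L := S) (fundamentalRep (Fin 3))
    (continuous_fundamentalRep (Fin 3)) β
  have hWint : Integrable (fun U => W S mq l U)
      (wilsonMeasure (d := 4) (L := S) (fundamentalRep (Fin 3)) β) :=
    hWcont.integrable_of_hasCompactSupport (HasCompactSupport.of_compactSpace _)
  have hZpos : 0 < ∫ U, W S mq l U ∂(wilsonMeasure (d := 4) (L := S) (fundamentalRep (Fin 3)) β) := by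
    rw [integral_pos_iff_support_of_nonneg (fun U => (hWpos U).le) hWint]
    have hsupp : Function.support (fun U => W S mq l U) = Set.univ :=
      Set.eq_univ_of_forall fun U => (hWpos U).ne'
    rw [hsupp, measure_univ]
    exact one_pos
  have hZne : (∫ U, (W S mq l U : ℂ) ∂(wilsonMeasure (d := 4) (L := S) (fundamentalRep (Fin 3)) β)) ≠ 0 := by
    rw [integral_complex_ofReal]
    exact Complex.ofReal_ne_zero.2 hZpos.ne'
  -- reweighting: `W · (g / W) = g` pointwise
  have hcancel : ∀ g : GaugeConfig 4 S (Matrix.specialUnitaryGroup (Fin 3) ℂ) → ℂ,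
      (fun U => (W S mq l U : ℂ) * (g U / W S mq l U)) = g :=
    fun g => funext fun U => mul_div_cancel₀ (g U) (hWne U)
  show qcdTorusExpect β S mq X =
    (∫ U, (W S mq l U : ℂ) * (fermiIntegral (X U * fermiBoltzmann U mq) / W S mq l U)
        ∂(wilsonMeasure (d := 4) (L := S) (fundamentalRep (Fin 3)) β)) /
      (∫ U, (W S mq l U : ℂ) ∂(wilsonMeasure (d := 4) (L := S) (fundamentalRep (Fin 3)) β)) /
    ((∫ U, (W S mq l U : ℂ) * (fermiIntegral (fermiBoltzmann U mq) / W S mq l U)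
        ∂(wilsonMeasure (d := 4) (L := S) (fundamentalRep (Fin 3)) β)) /
      (∫ U, (W S mq l U : ℂ) ∂(wilsonMeasure (d := 4) (L := S) (fundamentalRep (Fin 3)) β)))
  rw [hcancel, hcancel, div_div_div_cancel_right₀ hZne]
  rfl

end Summit.QuantumFields.QCD.Theorems.MultibosonBridge
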